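import Mathlib
import Summits.NavierStokesRegularity.NavierStokesRegularity.Theorems.TaoLadderRungTwoBreakBlowupRigidityOneVoidTables
import Summits.NavierStokesRegularity.NavierStokesRegularity.Theorems.TaoLadderRungTwoBreakBlowupRigidityOneTwoShellFlow
import HarnessLib

/-!
# ONE-HOP TABLES: a LIVE corner of `E₂(R)` on which K2(1) `TaoLadderRungTwoBreak.BlowupRigidityOne`
  (stmt-NavierStokesRegularity-20206) and the rung leaf `Target` hold at EVERY scale ratio and from EVERY one-shell
  datum — tables whose outflow lands in a set `D` of modes that can neither emit nor be rotated out of: the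
  one-shell datum generates a GLOBAL EXACT two-shell flow (energy hops from shell `0` to shell `1` and stops), so
  there is no Theorem-4.2-level blow-up (`--supports stmt-NavierStokesRegularity-20206`)

MODEL lattice ODEs only (Tao 2016 §4 (4.1)–(4.3), Lemma 4.1 (4.5)–(4.11), Thm. 4.2 statement shape, §5 (ode)–(g-cancel));
nothing here is a statement about the Navier–Stokes equations; NO item is closed.  DEF-FREE (the one-hop hypotheses
are three displayed vanishing conditions on the structure constants; the live table is displayed); ROUTE-INDEPENDENT
MODULE (no `Theses` import; the restricted statements of K2(1) / `Target` are spelled out).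

THE CLASS.  A table `α` on `m` modes is ONE-HOP with dead set `D ⊆ Fin m` when
  (H1) `α_{jk i,(0,0,1)} = 0` for all `j, k` and all `i ∉ D`   — the outflow of every state lands in `D`;
  (H2) `α_{jk i,(0,0,1)} = 0` for all `j, k ∈ D` and all `i`   — a state supported in `D` does not emit;
  (H3) `α_{jk i,(0,0,0)} = 0` for all `j, k` and all `i ∉ D`   — the intra-shell field lands in `D`.
`D = univ` is the OUTFLOW-FREE corner of `…BlowupRigidityOneVoidTables` ((H1), (H3) vacuous; (H2) = `tableA α = 0`);
`D = {3}` contains the LIVE spread-one table of `SubDyadicSpread.exists_live_inTableClass_one` (`α_{123,(001)} =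
α_{213,(001)} = 1`, `α_{312,(100)} = α_{132,(010)} = −1`: cross outflow `x₁x₂ ↦` mode `3` of the shell above, which
cannot re-pair: `oneHop_liveTable`).  So this file exhibits tables of `E₂(1)` with a LIVE (cross) outflow and
genuinely multi-mode data on which the two aside leaves are settled — complementing the twin-rotor table (cross
outflow feeding BOTH twins, which re-pair and carry the dyadic chain, `…BlowupRigidityOneTwinRotorPseudo`): below
the dyadic spread a cascade needs RE-PAIRING of the fed modes.

* `twoShellField_dead_eq_zero`, `tableA_eq_zero_of_supported` — under (H1)+(H3) the `y`-components outside `D` of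
  the two-shell field (sibling tool file `…TwoShellFlow`) vanish identically, so the modes `i ∉ D` of shell `1` stay
  `0` along its trajectory, and by (H2) shell `1` NEVER EMITS: `A(y(t)) = 0`;
* `exists_regularExactFlow_of_oneHop`, `not_noGlobalCascade_of_oneHop` — a one-hop cancelling table carries, from
  every one-shell datum and for every horizon, an EXACT (4.5)-regular lattice flow (the global two-shell flow;
  `quadTerm_twoShell`); hence on `E₂(R)` NO robust blow-up (`noRegularExactFlow_of_noGlobalCascade`), every
  `ε₀ > 0`, every datum;
* `oneHop_liveTable`, `inTableClass_one_liveTable`, `exists_live_settled_inTableClass_one` — the live spread-one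
  table is one-hop with `D = {3}`: a member of `E₂(1)` with `α_{123,(0,0,1)} = 1` on which `¬ NoGlobalCascade ε₀ α X₀`
  for ALL `ε₀ > 0` and ALL `X₀`;
* `blowupRigidityOne_on_oneHop`, `target_on_oneHop` — K2(1)'s implication and the rung leaf's statement hold on
  one-hop tables of `E₂(R)` with no threshold (vacuously; spelled out, no route decl named).

HONEST LABEL: calibration of one aside leaf on an explicit LIVE sub-class; (H3) could be weakened to `Q(V_D) ⊆ V_D`
(invariance then needs uniqueness) — TODO(general form); no stub, crux, rung or summit is proved; rung 0.
-/

noncomputable section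

-- the summit and its single sub-problem share the name (CONVENTIONS §1)
set_option linter.dupNamespace false

open Set Filter Topology MeasureTheory
open scoped RealInnerProductSpace

namespace Summit.NavierStokesRegularity.NavierStokesRegularity.Theorems

namespace BlowupRigidityOne

open Literature.Analysis.FluidPDE Literature.Analysis.FluidPDE.TaoCascade
  Literature.Analysis.FluidPDE.Tao2016AveragedNS

variable {m : ℕ} {R ε₀ : ℝ} {α : Fin m → Fin m → Fin m → ℤ × ℤ × ℤ → ℝ}

/-! ## One-hop tables: the dead modes of shell 1 stay dark, so shell 1 never emits -/

/-- Under (H1) and (H3) the `y`-components outside `D` of the two-shell field vanish identically: for `i ∉ D`,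
`((1+ε₀)^{5/2} Q y + A x)_i = 0` for ALL `x, y`.
[cite: Tao2016AveragedNS, §4 (4.1), Lemma 4.1 (4.8); cell vocabulary (one-hop hypotheses (H1), (H3))] -/
theorem twoShellField_dead_eq_zero {D : Finset (Fin m)}
    (hAD : ∀ j k i, i ∉ D → α j k i ((0 : ℤ), (0 : ℤ), (1 : ℤ)) = 0)
    (hQD : ∀ j k i, i ∉ D → α j k i ((0 : ℤ), (0 : ℤ), (0 : ℤ)) = 0)
    (Λ₁ : ℝ) (x y : Em m) {i : Fin m} (hi : i ∉ D) :
    (Λ₁ • tableQ α y + tableA α x) i = 0 := by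
  simp only [PiLp.add_apply, PiLp.smul_apply, smul_eq_mul, tableQ_apply, tableA_apply, qform]
  rw [Finset.sum_eq_zero fun j _ => Finset.sum_eq_zero fun k _ => by rw [hQD j k i hi, zero_mul],
    Finset.sum_eq_zero fun j _ => Finset.sum_eq_zero fun k _ => by rw [hAD j k i hi, zero_mul]]
  ring

/-- Under (H2), a shell state supported in `D` does not emit: `A(y) = 0` if `y_i = 0` for all `i ∉ D`.
[cite: Tao2016AveragedNS, §4 (4.1), Lemma 4.1 (4.8); cell vocabulary (one-hop hypothesis (H2))] -/
theorem tableA_eq_zero_of_supported {D : Finset (Fin m)}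
    (hDD : ∀ j k i, j ∈ D → k ∈ D → α j k i ((0 : ℤ), (0 : ℤ), (1 : ℤ)) = 0)
    {y : Em m} (hy : ∀ i, i ∉ D → y i = 0) : tableA α y = 0 := by
  ext i
  simp only [tableA_apply, qform, PiLp.zero_apply]
  refine Finset.sum_eq_zero fun j _ => Finset.sum_eq_zero fun k _ => ?_
  by_cases hj : j ∈ D
  · by_cases hk : k ∈ D
    · rw [hDD j k i hj hk, zero_mul]
    · rw [hy k hk, mul_zero, mul_zero]
  · rw [hy j hj, zero_mul, mul_zero]

/-! ## The global exact two-shell flow of a one-hop table -/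

/-- **A ONE-HOP CANCELLING TABLE FLOWS GLOBALLY AND EXACTLY FROM EVERY ONE-SHELL DATUM.**  Let `α` be cancelling
and one-hop with dead set `D` ((H1)–(H3)).  For every `ε₀`, every horizon `T` and every one-shell datum `X₀` at
shell `0` there is an EXACT lattice flow on `[0,T]` (datum (4.7), the law (4.8) with no defect as a one-sided
derivative within `[0,T]`, the a priori weight (4.5)): the global trajectory of the energy-neutral two-shell field
from `(X₀, 0)` on shells `0, 1` and `0` elsewhere — the dead modes of shell `1` stay dark
(`twoShellField_dead_eq_zero`), so shell `1` never emits (`tableA_eq_zero_of_supported`) and the frozen shells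
`≥ 2` obey the law too (`quadTerm_twoShell`).  Amplitudes are bounded by `√(Σ X₀²)` (energy conservation).
[cite: Tao2016AveragedNS, §4 Lemma 4.1 (4.5), (4.7), (4.8), (4.12); §5 p. 25 (cancelling circuits are globally well posed)] -/
theorem exists_regularExactFlow_of_oneHop (hc : IsCancellingCoeff α) {D : Finset (Fin m)}
    (hAD : ∀ j k i, i ∉ D → α j k i ((0 : ℤ), (0 : ℤ), (1 : ℤ)) = 0)
    (hDD : ∀ j k i, j ∈ D → k ∈ D → α j k i ((0 : ℤ), (0 : ℤ), (1 : ℤ)) = 0)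
    (hQD : ∀ j k i, i ∉ D → α j k i ((0 : ℤ), (0 : ℤ), (0 : ℤ)) = 0)
    (ε₀ : ℝ) (X₀ : Fin m → ℝ) (T : ℝ) :
    ∃ X : Fin m → ℤ → ℝ → ℝ,
      (∀ i k, X i k 0 = if k = 0 then X₀ i else 0) ∧
      (∀ i k, ∀ t ∈ Icc 0 T, HasDerivWithinAt (X i k) (quadTerm ε₀ α X i k t) (Icc 0 T) t) ∧
      ∃ M : ℝ, ∀ t ∈ Icc 0 T, ∀ (i : Fin m) (k : ℤ),
        (1 + (1 + ε₀) ^ ((10 : ℝ) * k)) * |X i k t| ≤ M := by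
  classical
  set Λ₁ : ℝ := (1 + ε₀) ^ ((5 : ℝ) / 2) with hΛ₁
  -- the two-shell field and its global trajectory from `(X₀, 0)`
  set G : (Fin m ⊕ Fin m → ℝ) → (Fin m ⊕ Fin m → ℝ) := fun Z => Sum.elim
        (fun i => (tableQ α (WithLp.toLp 2 fun j => Z (Sum.inl j)) +
          tableB α (WithLp.toLp 2 fun j => Z (Sum.inr j)) (WithLp.toLp 2 fun j => Z (Sum.inl j))) i)
        (fun i => (Λ₁ • tableQ α (WithLp.toLp 2 fun j => Z (Sum.inr j)) +
          tableA α (WithLp.toLp 2 fun j => Z (Sum.inl j))) i) with hG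
  set z₀ : Fin m ⊕ Fin m → ℝ := Sum.elim X₀ (fun _ => 0) with hz₀
  obtain ⟨Z, hZ0, hZ, hZb⟩ := exists_solution_of_sum_mul_eq_zero G
    (fun Z => sum_twoShellField_mul_eq_zero hc Λ₁ Z) (contDiff_twoShellField α Λ₁) z₀
  -- the shell paths
  set x : ℝ → Fin m → ℝ := fun t j => Z t (Sum.inl j) with hx
  set y : ℝ → Fin m → ℝ := fun t j => Z t (Sum.inr j) with hy
  have hxd : ∀ t i, HasDerivAt (fun t => x t i)
      ((tableQ α (WithLp.toLp 2 (x t)) + tableB α (WithLp.toLp 2 (y t)) (WithLp.toLp 2 (x t))) i) t := by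
    intro t i
    have h := (hasDerivAt_pi.1 (hZ t)) (Sum.inl i)
    simpa [hG] using h
  have hyd : ∀ t i, HasDerivAt (fun t => y t i)
      ((Λ₁ • tableQ α (WithLp.toLp 2 (y t)) + tableA α (WithLp.toLp 2 (x t))) i) t := by
    intro t i
    have h := (hasDerivAt_pi.1 (hZ t)) (Sum.inr i)
    simpa [hG] using h
  -- the dead modes of shell 1 stay dark
  have hydead : ∀ t i, i ∉ D → y t i = 0 := by
    intro t i hi
    have hconst := is_const_of_deriv_eq_zero (f := fun t => y t i)
      (fun t => (hyd t i).differentiableAt)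
      (fun t => by rw [(hyd t i).deriv]; exact twoShellField_dead_eq_zero hAD hQD Λ₁ _ _ hi) t 0
    rw [hconst]
    show Z 0 (Sum.inr i) = 0
    rw [hZ0, hz₀, Sum.elim_inr]
  have hAy : ∀ t, tableA α (WithLp.toLp 2 (y t)) = 0 := fun t =>
    tableA_eq_zero_of_supported hDD fun i hi => by simp [hydead t i hi]
  -- the lattice family
  refine ⟨fun i k t => if k = 0 then x t i else if k = 1 then y t i else 0, fun i k => ?_, fun i k t _ => ?_,
    ⟨(2 + |(1 + ε₀) ^ ((10 : ℝ) * ((1 : ℤ) : ℝ))|) * Real.sqrt (∑ r, z₀ r ^ 2), fun t _ i k => ?_⟩⟩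
  · -- datum
    by_cases hk : k = 0
    · subst hk
      simp only [if_true]
      show Z 0 (Sum.inl i) = X₀ i
      rw [hZ0, hz₀, Sum.elim_inl]
    · by_cases hk1 : k = 1
      · subst hk1
        simp only [one_ne_zero, if_false, if_true]
        show Z 0 (Sum.inr i) = 0
        rw [hZ0, hz₀, Sum.elim_inr]
      · simp [hk, hk1]
  · -- exact motion on every shell
    rw [quadTerm_twoShell]
    by_cases hk : k = 0
    · subst hk
      simp only [if_true]
      exact (hxd t i).hasDerivWithinAt
    · by_cases hk1 : k = 1
      · subst hk1
        simp only [one_ne_zero, if_false, if_true]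
        exact (hyd t i).hasDerivWithinAt
      · by_cases hk2 : k = 2
        · subst hk2
          simp only [show ((2 : ℤ) = 0) ↔ False by decide, show ((2 : ℤ) = 1) ↔ False by decide, if_false,
            if_true, hAy t, PiLp.zero_apply, mul_zero]
          exact hasDerivWithinAt_const _ _ _
        · simp only [hk, hk1, hk2, if_false]
          exact hasDerivWithinAt_const _ _ _
  · -- a priori weight (4.5): two live shells, amplitudes ≤ √(Σ X₀²)
    have hsq : 0 ≤ Real.sqrt (∑ r, z₀ r ^ 2) := Real.sqrt_nonneg _
    by_cases hk : k = 0
    · subst hk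
      simp only [if_true, Int.cast_zero, mul_zero, Real.rpow_zero]
      have hb : |x t i| ≤ Real.sqrt (∑ r, z₀ r ^ 2) := hZb t (Sum.inl i)
      have h2 : (1 + 1 : ℝ) ≤ 2 + |(1 + ε₀) ^ ((10 : ℝ) * ((1 : ℤ) : ℝ))| := by
        linarith [abs_nonneg ((1 + ε₀) ^ ((10 : ℝ) * ((1 : ℤ) : ℝ)))]
      exact mul_le_mul h2 hb (abs_nonneg _) (by positivity)
    · by_cases hk1 : k = 1
      · subst hk1
        simp only [one_ne_zero, if_false, if_true]
        have hb : |y t i| ≤ Real.sqrt (∑ r, z₀ r ^ 2) := hZb t (Sum.inr i)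
        have h2 : 1 + (1 + ε₀) ^ ((10 : ℝ) * ((1 : ℤ) : ℝ)) ≤ 2 + |(1 + ε₀) ^ ((10 : ℝ) * ((1 : ℤ) : ℝ))| := by
          linarith [le_abs_self ((1 + ε₀) ^ ((10 : ℝ) * ((1 : ℤ) : ℝ)))]
        by_cases hw : 0 ≤ 1 + (1 + ε₀) ^ ((10 : ℝ) * ((1 : ℤ) : ℝ))
        · exact mul_le_mul h2 hb (abs_nonneg _) (by positivity)
        · push Not at hw
          exact le_trans (mul_nonpos_of_nonpos_of_nonneg hw.le (abs_nonneg _)) (by positivity)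
      · simp only [hk, hk1, if_false, abs_zero, mul_zero]
        positivity

/-- **NO ROBUST BLOW-UP ON A ONE-HOP TABLE.**  If `α ∈ E₂(R)` is one-hop with dead set `D` ((H1)–(H3)), then
`NoGlobalCascade ε₀ α X₀` FAILS for every `ε₀ > 0` and every one-shell datum `X₀` — a robust blow-up would forbid
a (4.5)-regular exact flow on some `[0,T]` (`noRegularExactFlow_of_noGlobalCascade`), but the two-shell flow is
one.  `D = univ` is `not_noGlobalCascade_of_outflow_zero` (VoidTables); `D = {3}` covers the live spread-one table.
[cite: Tao2016AveragedNS, §4 Thm. 4.2 (statement shape), Lemma 4.1 (4.5)–(4.8), §5 p. 25; cell vocabulary (`NoGlobalCascade`)] -/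
theorem not_noGlobalCascade_of_oneHop (hε : 0 < ε₀) (hα : InTableClass R α) {D : Finset (Fin m)}
    (hAD : ∀ j k i, i ∉ D → α j k i ((0 : ℤ), (0 : ℤ), (1 : ℤ)) = 0)
    (hDD : ∀ j k i, j ∈ D → k ∈ D → α j k i ((0 : ℤ), (0 : ℤ), (1 : ℤ)) = 0)
    (hQD : ∀ j k i, i ∉ D → α j k i ((0 : ℤ), (0 : ℤ), (0 : ℤ)) = 0) (X₀ : Fin m → ℝ) :
    ¬ NoGlobalCascade ε₀ α X₀ := by
  intro hNG
  obtain ⟨T, _, hno⟩ := noRegularExactFlow_of_noGlobalCascade hε hα hNG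
  exact hno (exists_regularExactFlow_of_oneHop hα.2.1 hAD hDD hQD ε₀ X₀ T)

/-! ## A live member of `E₂(1)` settled at every scale ratio -/

/-- **The live spread-one table is one-hop with dead set `{3}`.**  The `{0,±1}`-valued table with
`α_{123,(0,0,1)} = α_{213,(0,0,1)} = 1`, `α_{312,(1,0,0)} = α_{132,(0,1,0)} = −1` (all other entries `0`;
`SubDyadicSpread.exists_live_inTableClass_one`) satisfies (H1)–(H3) with `D = {3}`: its outflow lands in mode `3`,
mode `3` alone does not emit (no square monomial), and it has no intra-shell block.
[cite: Tao2016AveragedNS, §4 (4.1)–(4.3), §6.1; cell vocabulary (`InTableClass`)] -/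
theorem oneHop_liveTable :
    let α : Fin 4 → Fin 4 → Fin 4 → ℤ × ℤ × ℤ → ℝ := fun i₁ i₂ i₃ μ =>
      if i₃ = 3 ∧ ((i₁ = 1 ∧ i₂ = 2) ∨ (i₁ = 2 ∧ i₂ = 1)) ∧ μ = ((0 : ℤ), (0 : ℤ), (1 : ℤ)) then 1
      else if i₁ = 3 ∧ i₂ = 1 ∧ i₃ = 2 ∧ μ = ((1 : ℤ), (0 : ℤ), (0 : ℤ)) then -1
      else if i₁ = 1 ∧ i₂ = 3 ∧ i₃ = 2 ∧ μ = ((0 : ℤ), (1 : ℤ), (0 : ℤ)) then -1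
      else 0
    (∀ j k i, i ∉ ({3} : Finset (Fin 4)) → α j k i ((0 : ℤ), (0 : ℤ), (1 : ℤ)) = 0) ∧
    (∀ j k i, j ∈ ({3} : Finset (Fin 4)) → k ∈ ({3} : Finset (Fin 4)) → α j k i ((0 : ℤ), (0 : ℤ), (1 : ℤ)) = 0) ∧
    (∀ j k i, i ∉ ({3} : Finset (Fin 4)) → α j k i ((0 : ℤ), (0 : ℤ), (0 : ℤ)) = 0) := by
  refine ⟨?_, ?_, ?_⟩
  · intro j k i hi
    simp only [Finset.mem_singleton] at hi
    simp [hi]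
  · intro j k i hj hk
    simp only [Finset.mem_singleton] at hj hk
    subst hj; subst hk
    simp
  · intro j k i _
    simp

/-- The live spread-one table lies in `InTableClass 1` (symmetric, cancelling, every constant `0` or `±1`) — the
membership proof of `SubDyadicSpread.exists_live_inTableClass_one`, restated for the displayed table.
[cite: Tao2016AveragedNS, §4 (4.2)–(4.3), §6.1; cell vocabulary (`InTableClass`)] -/
theorem inTableClass_one_liveTable :
    InTableClass 1 (fun (i₁ i₂ i₃ : Fin 4) (μ : ℤ × ℤ × ℤ) =>
      if i₃ = 3 ∧ ((i₁ = 1 ∧ i₂ = 2) ∨ (i₁ = 2 ∧ i₂ = 1)) ∧ μ = ((0 : ℤ), (0 : ℤ), (1 : ℤ)) then (1 : ℝ)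
      else if i₁ = 3 ∧ i₂ = 1 ∧ i₃ = 2 ∧ μ = ((1 : ℤ), (0 : ℤ), (0 : ℤ)) then -1
      else if i₁ = 1 ∧ i₂ = 3 ∧ i₃ = 2 ∧ μ = ((0 : ℤ), (1 : ℤ), (0 : ℤ)) then -1
      else 0) := by
  refine ⟨?_, ?_, ?_⟩
  · intro i₁ i₂ i₃ μ₁ μ₂ μ₃ hμ
    rw [mem_shiftSet_iff] at hμ
    simp only [Prod.mk.injEq] at hμ
    rcases hμ with ⟨rfl, rfl, rfl⟩ | ⟨rfl, rfl, rfl⟩ | ⟨rfl, rfl, rfl⟩ | ⟨rfl, rfl, rfl⟩ <;>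
      fin_cases i₁ <;> fin_cases i₂ <;> fin_cases i₃ <;> simp +decide
  · intro i₁ i₂ i₃ μ₁ μ₂ μ₃ hμ
    rw [mem_shiftSet_iff] at hμ
    simp only [Prod.mk.injEq] at hμ
    rcases hμ with ⟨rfl, rfl, rfl⟩ | ⟨rfl, rfl, rfl⟩ | ⟨rfl, rfl, rfl⟩ | ⟨rfl, rfl, rfl⟩ <;>
      fin_cases i₁ <;> fin_cases i₂ <;> fin_cases i₃ <;> simp +decide
  · intro i₁ i₂ i₃ μ _
    rw [inv_one]
    by_cases hA : i₃ = 3 ∧ ((i₁ = 1 ∧ i₂ = 2) ∨ (i₁ = 2 ∧ i₂ = 1)) ∧ μ = ((0 : ℤ), (0 : ℤ), (1 : ℤ))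
    · simp +decide [hA]
    · by_cases hB : i₁ = 3 ∧ i₂ = 1 ∧ i₃ = 2 ∧ μ = ((1 : ℤ), (0 : ℤ), (0 : ℤ))
      · simp +decide [hB]
      · by_cases hC : i₁ = 1 ∧ i₂ = 3 ∧ i₃ = 2 ∧ μ = ((0 : ℤ), (1 : ℤ), (0 : ℤ))
        · simp +decide [hC]
        · simp +decide [hA, hB, hC]

/-- **A LIVE MEMBER OF `E₂(1)` ON WHICH THE TARGET HOLDS AT EVERY SCALE RATIO.**  There is a table in
`InTableClass 1` (hence in every `E₂(R)`, `R ≥ 1`) with a LIVE cross outflow `α_{123,(0,0,1)} = 1` such that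
`¬ NoGlobalCascade ε₀ α X₀` for EVERY `ε₀ > 0` and EVERY one-shell datum `X₀` (multi-mode included): the one-hop
table of `oneHop_liveTable`.  The rung leaf and K2(1) are thus settled (vacuously) on a live sub-dyadic table —
below the dyadic spread a cascade needs the fed modes to RE-PAIR (contrast: the twin rotor).
[cite: Tao2016AveragedNS, §4 (4.1)–(4.3), Thm. 4.2 (statement shape), §6.1; cell vocabulary (`InTableClass`, `NoGlobalCascade`)] -/
theorem exists_live_settled_inTableClass_one :
    ∃ α : Fin 4 → Fin 4 → Fin 4 → ℤ × ℤ × ℤ → ℝ, InTableClass 1 α ∧ α 1 2 3 (0, 0, 1) = 1 ∧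
      ∀ ε₀ : ℝ, 0 < ε₀ → ∀ X₀ : Fin 4 → ℝ, ¬ NoGlobalCascade ε₀ α X₀ := by
  obtain ⟨hAD, hDD, hQD⟩ := oneHop_liveTable
  exact ⟨_, inTableClass_one_liveTable, by simp, fun ε₀ hε X₀ =>
    not_noGlobalCascade_of_oneHop (R := 1) hε inTableClass_one_liveTable hAD hDD hQD X₀⟩

/-- **K2(1) ON ONE-HOP TABLES, EVERY `ε₀`.**  The implication of `TaoLadderRungTwoBreak.BlowupRigidityOne` — robust
blow-up ⇒ a non-trivial (S₁)-surviving admissible DSS wave — holds for every one-hop table of `E₂(R)` and every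
one-shell datum at EVERY `ε₀ > 0`, because its hypothesis is void there (`not_noGlobalCascade_of_oneHop`).
[cite: Tao2016AveragedNS, §4 Thm. 4.2 (statement shape), §6.4; cell vocabulary (K2(1))] -/
theorem blowupRigidityOne_on_oneHop (hε : 0 < ε₀) (α : Fin 4 → Fin 4 → Fin 4 → ℤ × ℤ × ℤ → ℝ)
    (X₀ : Fin 4 → ℝ) (hα : InTableClass R α) {D : Finset (Fin 4)}
    (hAD : ∀ j k i, i ∉ D → α j k i ((0 : ℤ), (0 : ℤ), (1 : ℤ)) = 0)
    (hDD : ∀ j k i, j ∈ D → k ∈ D → α j k i ((0 : ℤ), (0 : ℤ), (1 : ℤ)) = 0)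
    (hQD : ∀ j k i, i ∉ D → α j k i ((0 : ℤ), (0 : ℤ), (0 : ℤ)) = 0) (hNG : NoGlobalCascade ε₀ α X₀) :
    ∃ (q : ℕ) (π : Equiv.Perm (Fin q)) (T : ℝ) (Φ : Fin q → ℝ → Em 4),
      IsDSSWave ε₀ α π T Φ ∧ Surviving 1 ε₀ T ∧ ∃ r x, Φ r x ≠ 0 :=
  absurd hNG (not_noGlobalCascade_of_oneHop hε hα hAD hDD hQD X₀)

/-- **THE RUNG LEAF ON ONE-HOP TABLES, EVERY `ε₀`.**  The statement of `Target` (no robust blow-up) restricted to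
one-hop tables of `E₂(R)` holds with NO threshold on `ε₀`.
[cite: Tao2016AveragedNS, §4 Thm. 4.2 (statement shape); cell vocabulary (`Target` = `RungTwoBreakLatt`)] -/
theorem target_on_oneHop (hε : 0 < ε₀) (α : Fin 4 → Fin 4 → Fin 4 → ℤ × ℤ × ℤ → ℝ) (X₀ : Fin 4 → ℝ)
    (hα : InTableClass R α) {D : Finset (Fin 4)}
    (hAD : ∀ j k i, i ∉ D → α j k i ((0 : ℤ), (0 : ℤ), (1 : ℤ)) = 0)
    (hDD : ∀ j k i, j ∈ D → k ∈ D → α j k i ((0 : ℤ), (0 : ℤ), (1 : ℤ)) = 0)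
    (hQD : ∀ j k i, i ∉ D → α j k i ((0 : ℤ), (0 : ℤ), (0 : ℤ)) = 0) : ¬ NoGlobalCascade ε₀ α X₀ :=
  not_noGlobalCascade_of_oneHop hε hα hAD hDD hQD X₀

end BlowupRigidityOne

end Summit.NavierStokesRegularity.NavierStokesRegularity.Theorems

end
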